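import Mathlib
import Literature.Topology.FourManifolds.Gluing
import Literature.Topology.FourManifolds.ClosedBall
import Literature.Topology.FourManifolds.Handles
import Literature.Topology.FourManifolds.MazurDouble
import Literature.Topology.FourManifolds.MazurDoubleHolds
import Literature.Geometry.Symplectic.SteinDomain
import Literature.Geometry.Symplectic.PlanarContactBoundary
import HarnessLib

/-!
# PlanarHomologySphereFillings

Topic `Literature/Geometry/Symplectic`. Named literature fact(s) relocated by the gate from `Summits/SmoothPoincare4/SmoothPoincare4/Theorems/ConvexBisectionPlanarAcyclicBisectionRigidityHelperObaMazur.lean`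
(accept-time relocation of `[cite]`d propositions written inline in a Summits proposal; human ruling 2026-08-15).
Sources: Oba2016.

* `Literature.Geometry.Symplectic.Oba2016_steinFilling_fourHoledSphere`
-/

namespace Literature.Geometry.Symplectic

open scoped _root_.Manifold _root_.ContDiff _root_.Topology
open _root_.Set _root_.Function _root_.Literature.Topology.FourManifolds _root_.Literature.Geometry.Symplectic

/-- **Oba 2016, Theorem 1.1 — Stein fillings of planar integral homology spheres with page
`Σ_{0,4}` (special case: contractible fillings).**  T. Oba, *Stein fillings of homology
`3`-spheres and mapping class groups*, Geom. Dedicata 183 (2016), 69–80 (arXiv:1407.5257),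
Thm. 1.1: *"Let `M` be an integral homology `3`-sphere.  Suppose that a contact structure `ξ` on
`M` is Stein fillable and supported by an open book decomposition with page `Σ_{0,4}`.  Then the
contact `3`-manifold `(M, ξ)` admits a unique Stein filling up to diffeomorphism.  Furthermore
this Stein filling is diffeomorphic to either the `4`-disk `D⁴` or a Mazur type manifold"*, where
(loc. cit., after Thm. 1.1) a `4`-manifold is *of Mazur type* if it is contractible, its boundary
is not diffeomorphic to `S³`, and it admits a handle decomposition consisting of one `0`-handle,
one `1`-handle and one `2`-handle (proof, §3.2: Wendl's theorem makes the filling a PALF over the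
given open book with three singular fibres, Prop. 3.6; `Mod(Σ_{0,4}) ≅ ℤ⁴ × F₂`, the `PSL(2, ℤ)`
trace argument, and a Kirby diagram with two cancelling pairs of `1`- and `2`-handles).  Rendered in the
tree's vocabulary for the case the route meets: `W` a compact CONTRACTIBLE Stein domain
(`SteinStructure W`; then `∂W` is connected and an integral homology `3`-sphere by
Poincaré–Lefschetz duality, and `(W, S)` is a Stein filling of its boundary contact structure, the
complex tangencies `boundaryPlaneField S.J b` read on a boundary datum `b`), that contact structure
supported — `OpenBook.Supports`, i.e. the kernel of a Giroux form, the boundary being oriented by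
the contact structure itself as in `PlanarContactBoundary.lean` — by a PLANAR open book
(`OpenBook.IsPlanar`) with FOUR binding components (`ob.k = 4`; on the connected `∂W` the pages are
connected of genus `0` with four boundary circles, i.e. `Σ_{0,4}`).  Conclusion: `W ≅ D⁴`, or `W`
carries a Morse function adapted to `∂W` with exactly one critical point of each index `0, 1, 2`
and none of index `≥ 3` (`HasHandleDecomposition 3 W (1, 1, 1, 0, …)`, the tree's reading of "one
`0`-handle, one `1`-handle, one `2`-handle", the hypothesis of
`Literature.Topology.FourManifolds.Mazur1961_double_sphere_four`).  The uniqueness clause is not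
restated.  Users take `(h : Literature.Geometry.Symplectic.Oba2016_steinFilling_fourHoledSphere)`.
-- TODO(general form): any Stein filling of any integral homology `3`-sphere so supported (not
-- only a contractible `W`), and uniqueness of the filling up to diffeomorphism.
[cite: Oba2016, Thm. 1.1] [file Geometry/Symplectic/PlanarHomologySphereFillings] -/
def _root_.Literature.Geometry.Symplectic.Oba2016_steinFilling_fourHoledSphere : Prop :=
  ∀ (W : Type) [TopologicalSpace W] [T2Space W] [SecondCountableTopology W]
    [ChartedSpace (EuclideanHalfSpace 4) W] [IsManifold (𝓡∂ 4) ∞ W] [CompactSpace W]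
    [ContractibleSpace W] (S : SteinStructure W),
    (∃ (b : BoundaryData (𝓡∂ 4) W (𝓡 3)) (ob : OpenBook b.carrier),
        ob.IsPlanar ∧ ob.k = 4 ∧ ob.Supports (boundaryPlaneField S.J b)) →
    Nonempty (W ≃ₘ⟮𝓡∂ 4, 𝓡∂ 4⟯ Metric.closedBall (0 : EuclideanSpace ℝ (Fin 4)) 1) ∨
      HasHandleDecomposition 3 W (fun k => if k ≤ 2 then 1 else 0)

end Literature.Geometry.Symplectic
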